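import Summits.QuantumFields.GaugeBoot.Certificates.SparseReducedWalk
import HarnessLib

/-!
# Shared equality rows and column table `N1c2D3b1`, data part 2/4 (gb_lean_emit_reduced 0.8.2)

HONEST FRAMING (cell `pub-gaugeboot`): certified bounds on lattice expectations at stated coupling,
gauge group, dimension and torus size; NOT a mass gap, NOT a continuum limit, NOT a string tension;
NOT Yang–Mills-summit-bearing (barriers `FixedCouplingUltralocality`, `PerturbativeInvisibility`).
The 346 exact equality rows (sources: G2:direct(rref): 346; 7550 non-zeros) shared by the
certsdp problems of this β (e.g. `glyzc2_D3_b1_min_rp_G2_xblocks`, sha256 `396be5f5b9678d3e4e3392a5c7dd35b7e91b9ada3ccd0df92cf7a96d1941fd54`; the upper- and lower-end problems of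
one window row carry identical rows). `RW[e] = (rhs_e, row_e)` with the sparse row `[(v, coeff), …]`; the interface
`rowEQ`/`rhsQ` is what a lattice binding discharges ONCE for both ends (same shape as the `N1c1D3b<β>` modules).
`CT2` is the two-level COLUMN table of the same matrix (`Sparse.getC CT2 33 v = [(e, row_e[v]), …]`), re-checked
against `RW` once (`colCheck` / `rowCheck` of `Certificates/SparseReducedWalk.lean`) so that the certificate
modules compute their residuals column-wise in linear time. Data parts are concatenated in the main module.
-/

namespace Summit.QuantumFields.GaugeBoot.Certificates.N1c2D3b1

noncomputable section

open Summit.QuantumFields.GaugeBoot.Certificates.Sparse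

set_option maxHeartbeats 0 in
set_option maxRecDepth 100000 in
/-- Equality rows 338 ≤ e < 346: `(rhs_e, [(v, coeff), …])`. -/
def RWb : List (ℚ × List (ℕ × ℚ)) := [
  ((0 : ℚ), ([(1388, (1 : ℚ)), (1394, (1 : ℚ)), (1432, (-1 : ℚ)), (1436, (-1 : ℚ))] : List (ℕ × ℚ))), ((0 : ℚ), ([(1402, (1 : ℚ)), (1403, (-1 : ℚ)), (1406, (-1 : ℚ)), (1407, (1 : ℚ))] : List (ℕ × ℚ))), ((0 : ℚ), ([(1409, (1 : ℚ)), (1427, (1 : ℚ)), (1446, (-1 : ℚ)), (1448, (-1 : ℚ))] : List (ℕ × ℚ))), ((0 : ℚ), ([(1411, (1 : ℚ)), (1416, (-1 : ℚ)), (1419, (1 : ℚ)), (1423, (-1 : ℚ))] : List (ℕ × ℚ))), ((0 : ℚ), ([(1412, (1 : ℚ)), (1415, (-1 : ℚ)), (1420, (-1 : ℚ)), (1422, (1 : ℚ))] : List (ℕ × ℚ))), ((0 : ℚ), ([(1413, (1 : ℚ)), (1417, (-1 : ℚ)), (1425, (1 : ℚ)), (1426, (-1 : ℚ))] : List (ℕ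 × ℚ))), ((0 : ℚ), ([(1414, (1 : ℚ)), (1418, (-1 : ℚ)), (1421, (1 : ℚ)), (1424, (-1 : ℚ))] : List (ℕ × ℚ))), ((0 : ℚ), ([(1430, (1 : ℚ)), (1434, (1 : ℚ)), (1441, (-1 : ℚ)), (1445, (-1 : ℚ))] : List (ℕ × ℚ)))
]

end

end Summit.QuantumFields.GaugeBoot.Certificates.N1c2D3b1
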